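import Literature.AlgebraicGeometry.Frobenioids.ArchimedeanFSM
import Literature.AlgebraicGeometry.Frobenioids.ArchimedeanHalfCircleLifts
import HarnessLib

/-!
# Frobenioids II, Proposition 3.4 (iii): the COUNTEREXAMPLE over `D := D₀`, rigidified angloid `R`
# (abc-iut cell, layer L1, node `FrdII:Prop3.4(iii)`, chain LC-L1-2 — refutation, `F = R`)

Mochizuki, *The geometry of Frobenioids II: poly-Frobenioids*, Kyushu J. Math. **62** (2008)
401–460, §3, Proposition 3.4 (iii) p. 30 ("FSM-morphisms of `F` project to FSM-morphisms of `D`",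
`F ∈ {A, N, R}`), proof p. 31. [cite: MochizukiFrdII2008, Prop 3.4 (iii) p.30]

PROVED here (proof-only, nothing defined): the `R`-conjunct of the typed item is FALSE at
`π = 𝟭 D₀`: `towerR_id_not_propIII : ¬ (towerR (𝟭 D0)).PropIII`. Same witness as for `N`
(`ArchimedeanFSMCounterexample.lean`), read in the rigidified angloid `R = R₀ ×_{D₀} D₀`,
`R₀ = (N₀)_{/real unit}`: the object `X = (Spec ℂ, right half-circle, tip 1)` is given the structure
arrow `φ₀ = (Spec ℂ → Spec ℝ, 1, i)` to the real unit, `Y` is the real unit over itself, and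
`φ = (φ₀, Spec ℂ → Spec ℝ)`. In `R` any two arrows `a, b : V → X` satisfy `φ₀ ∘ a₀ = φ₀ ∘ b₀` (both are
the structure arrow of `V`), so the monomorphism argument is that of `N` (`C0.no_conj_pair_of_re_pos`);
fiberwise-surjectivity is that of `N` with the structure arrow of the test object `V` taken to be
`φ₀ ∘ δ₁` (`C0.exists_factor_real`, `C0.exists_lift_pair`, `exists_mem_im_ne_zero`). The projection
`Spec ℂ → Spec ℝ` is not a monomorphism of `D₀`. No side is taken on [IUTchIII] Cor. 3.12.
-/

namespace Literature.AlgebraicGeometry.Frobenioids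

open CategoryTheory Set
open scoped Pointwise

noncomputable section

namespace ArchFrd

/-- **Prop. 3.4 (iii) fails for `F = R` over `D = D₀`**: the arrow
`φ = ((Spec ℂ → Spec ℝ, 1, i), Spec ℂ → Spec ℝ)` from the right-half-circle object (structured by that
same arrow) to the real unit is an FSM-morphism of `R` whose projection `Spec ℂ → Spec ℝ` is not a
monomorphism of `D₀`. [cite: MochizukiFrdII2008, Prop 3.4 (iii) p.30] -/
theorem towerR_id_not_propIII : ¬ (towerR (𝟭 D0)).PropIII := by
  intro hIII
  have hπ2 : (0 : ℝ) < Real.pi / 2 := by linarith [Real.pi_pos]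
  have hπ2' : Real.pi / 2 < Real.pi := by linarith [Real.pi_pos]
  let RX : AngularRegion ℂ := arcRegion 1 (Real.pi / 2) hπ2 hπ2' 1
  have hRX : D0.complex = D0.real → RX.IsIsotropic := fun h => nomatch h
  have hRXd : RX.dir = arcDir 1 (Real.pi / 2) := rfl
  have hRXt : RX.tip = 1 := rfl
  let X0 : C0 := ⟨D0.complex, RX, hRX⟩
  let Iu : ℂˣ := Units.mk0 Complex.I Complex.I_ne_zero
  have hsub : ∀ (K : D0) (f g : K ⟶ D0.real), f = g := fun K f g => Subsingleton.elim f g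
  -- the arrow φ₀ = (Spec ℂ → Spec ℝ, 1, i), also the structure arrow of X
  have hmaps : Iu • X0.region.carrier ^ ((1 : ℕ+) : ℕ) ⊆ C0.pullRegion (C0.realOfTip 1) D0.toRealHom := by
    rw [PNat.one_coe, pow_one]
    rintro _ ⟨x, hx, rfl⟩
    show Iu • x ∈ D0.toRealHom.act '' (AngularRegion.isotropicOfTip (K := ℂ) 1).carrier
    unfold D0.Hom.act
    rw [D0.twists_toRealHom, D0.image_galAct_false,
      C0.mem_carrier_of_isIsotropic (AngularRegion.isIsotropic_isotropicOfTip 1), absHom_le_iff,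
      smul_eq_mul, Units.val_mul, norm_mul]
    show ‖Complex.I‖ * ‖(x : ℂ)‖ ≤ ((1 : PosReal) : ℝ)
    rw [Complex.norm_I, one_mul]
    exact (absHom_le_iff x RX.tip).mp hx.2
  have hmem : Iu ∈ D0.scalars X0.base := by
    show _ ∈ D0.scalars D0.complex
    rw [D0.scalars_complex]
    exact Subgroup.mem_top _
  let φ0 : X0 ⟶ C0.realOfTip 1 := ⟨D0.toRealHom, 1, Iu, hmem, hmaps⟩
  have hφI : PreFrobenioid.IsIsometry C0.toElem φ0 := by
    rw [A0.isIsometry_iff_norm_mul_tip_pow]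
    show ‖Complex.I‖ * ((1 : PosReal) : ℝ) ^ ((1 : ℕ+) : ℕ) = ((1 : PosReal) : ℝ)
    rw [Complex.norm_I, one_mul, PNat.one_coe, pow_one]
  -- the objects and the arrow of `R`
  let sX : (⟨⟨X0⟩⟩ : N0) ⟶ N0.realUnit := N0.homMk φ0 hφI rfl
  let rX : R0 := Over.mk sX
  let rY : R0 := Over.mk (𝟙 N0.realUnit)
  let X : R (𝟭 D0) := ⟨rX, D0.complex, Iso.refl _⟩
  let Y : R (𝟭 D0) := ⟨rY, D0.real, Iso.refl _⟩
  let φO : rX ⟶ rY := Over.homMk sX (Category.comp_id _)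
  let φ : X ⟶ Y := ⟨φO, D0.toRealHom, hsub _ _ _⟩
  -- φ is a monomorphism of R
  have hmono : Mono φ := by
    refine ⟨fun {V} a b _ => ?_⟩
    -- in R both composites with the structure arrow of X are the structure arrow of V
    have hC : N0.homCarrier a.fst.left ≫ φ0 = N0.homCarrier b.fst.left ≫ φ0 :=
      congrArg N0.homCarrier ((Over.w a.fst).trans (Over.w b.fst).symm)
    have ha1 : C0.degFr (N0.homCarrier a.fst.left) = 1 := a.fst.left.property
    have hb1 : C0.degFr (N0.homCarrier b.fst.left) = 1 := b.fst.left.property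
    by_cases ht : D0.Hom.twists (C0.Base (N0.homCarrier a.fst.left)) =
        D0.Hom.twists (C0.Base (N0.homCarrier b.fst.left))
    · have hbase : C0.Base (N0.homCarrier a.fst.left) = C0.Base (N0.homCarrier b.fst.left) :=
        D0.hom_eq_of_twists_eq _ _ ht
      have hsc := congrArg C0.scalar hC
      rw [C0.scalar_comp', C0.scalar_comp', hbase] at hsc
      have hscal : C0.scalar (N0.homCarrier a.fst.left) = C0.scalar (N0.homCarrier b.fst.left) := by
        have h' : C0.scalar (N0.homCarrier a.fst.left) ^ ((1 : ℕ+) : ℕ) =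
            C0.scalar (N0.homCarrier b.fst.left) ^ ((1 : ℕ+) : ℕ) := mul_left_cancel hsc
        rwa [PNat.one_coe, pow_one, pow_one] at h'
      have h0 : N0.homCarrier a.fst.left = N0.homCarrier b.fst.left :=
        C0.hom_ext hbase (ha1.trans hb1.symm) hscal
      have hO : a.fst = b.fst := Over.OverMorphism.ext (N0.hom_ext h0)
      have hD : a.snd = b.snd := by
        have wa := a.w
        have wb := b.w
        rw [hO] at wa
        exact (cancel_epi V.iso.hom).mp (wa.symm.trans wb)
      exact CFP.hom_ext hO hD
    · exact (C0.no_conj_pair_of_re_pos (X := X0) hRXd φ0 rfl rfl _ _ hC ht).elim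
  -- φ is fiberwise-surjective in R
  have hfs : IsFiberwiseSurjective φ := by
    intro W γ
    obtain ⟨rW, WD, ιW⟩ := W
    obtain ⟨⟨⟨⟨KW, RW, hRW⟩⟩⟩, ⟨⟨⟩⟩, sW⟩ := rW
    obtain ⟨γO, γD, wγ⟩ := γ
    have hsW : γO.left = sW := (Category.comp_id _).symm.trans (Over.w γO)
    have hγd : C0.degFr (N0.homCarrier γO.left) = 1 := γO.left.property
    have hγI : PreFrobenioid.IsIsometry C0.toElem (N0.homCarrier γO.left) := γO.left.hom.property
    cases KW with
    | real =>
      obtain ⟨δ0, hδd, hδI, hδ⟩ :=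
        C0.exists_factor_real hRW (N0.homCarrier γO.left) hγd hγI hRX hRXt φ0 rfl rfl
      let δN : (⟨⟨X0⟩⟩ : N0) ⟶ ⟨⟨C0.mk D0.real RW hRW⟩⟩ := N0.homMk δ0 hδI hδd
      have hcomm : δN ≫ γO.left = sX := N0.hom_ext hδ
      let δO : rX ⟶ ⟨⟨⟨C0.mk D0.real RW hRW⟩⟩, ⟨⟨⟩⟩, sW⟩ :=
        Over.homMk δN (by rw [← hsW]; exact hcomm)
      have hbδ : R0.toD0.map δO = D0.toRealHom := D0.hom_to_real_eq rfl _ _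
      have wδ : R0.toD0.map δO ≫ ιW.hom = X.iso.hom ≫ (𝟭 D0).map (D0.toRealHom ≫ ιW.hom) := by
        rw [hbδ]
        exact (Category.id_comp _).symm
      refine ⟨X, 𝟙 X, ⟨δO, D0.toRealHom ≫ ιW.hom, wδ⟩, ?_⟩
      rw [Category.id_comp]
      exact CFP.hom_ext (Over.OverMorphism.ext hcomm.symm) (hsub _ _ _)
    | complex =>
      -- a point z₁ of the angular part of W with Im (c_γ z₁ / |c_γ|) ≠ 0
      obtain ⟨z₁, hz₁, hz₁i⟩ := exists_mem_im_ne_zero RW.isOpen_dir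
        (let ⟨z, hz, _⟩ := (RW.isConnected_inter 1).nonempty; ⟨z, hz⟩)
        (unitPart ℂ (C0.scalar (N0.homCarrier γO.left)))
      have hcγ : ((C0.scalar (N0.homCarrier γO.left) : ℂˣ) : ℂ) =
          (‖((C0.scalar (N0.homCarrier γO.left) : ℂˣ) : ℂ)‖ : ℂ) *
            (((unitPart ℂ (C0.scalar (N0.homCarrier γO.left)) : ℂˣ)) : ℂ) := by
        have := congrArg (fun u : ℂˣ => (u : ℂ))
          (unitPart_mul_ofPosReal_absHom (K := ℂ) (C0.scalar (N0.homCarrier γO.left)))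
        simp only [Units.val_mul, coe_ofPosReal, coe_absHom] at this
        rw [mul_comm]
        exact this.symm
      have hcpos : 0 < ‖((C0.scalar (N0.homCarrier γO.left) : ℂˣ) : ℂ)‖ :=
        norm_pos_iff.mpr (C0.scalar (N0.homCarrier γO.left)).ne_zero
      set r : ℂ := (((unitPart ℂ (C0.scalar (N0.homCarrier γO.left)) * z₁ : ↥(normOneSubgroup ℂ)) :
        ℂˣ) : ℂ) with hr
      have hprod : ∀ σ : Bool,
          ((((D0.galAct σ Iu)⁻¹ * C0.scalar (N0.homCarrier γO.left) * (z₁ : ℂˣ) : ℂˣ) : ℂ)) =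
            (‖((C0.scalar (N0.homCarrier γO.left) : ℂˣ) : ℂ)‖ : ℂ) *
              ((((D0.galAct σ Iu : ℂˣ) : ℂ))⁻¹ * r) := by
        intro σ
        conv_lhs => rw [Units.val_mul, Units.val_mul, Units.val_inv_eq_inv_val, hcγ]
        rw [hr]
        push_cast
        ring
      have hval : ∀ σ : Bool, (((D0.galAct σ Iu : ℂˣ) : ℂ)) = if σ then -Complex.I else Complex.I := by
        intro σ
        cases σ
        · rw [D0.galAct_false]; rfl
        · rw [D0.galAct_true, Units.coe_star, ← starRingEnd_apply]
          show (starRingEnd ℂ) Complex.I = _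
          rw [Complex.conj_I]; rfl
      obtain ⟨σ, hre⟩ : ∃ σ : Bool,
          0 < ((((D0.galAct σ Iu)⁻¹ * C0.scalar (N0.homCarrier γO.left) * (z₁ : ℂˣ) : ℂˣ) :
            ℂ)).re := by
        by_cases hlt : r.im < 0
        · refine ⟨true, ?_⟩
          rw [hprod, hval, Complex.re_ofReal_mul, if_pos rfl]
          refine mul_pos hcpos ?_
          rw [inv_neg, Complex.inv_I, neg_neg, Complex.mul_re, Complex.I_re, Complex.I_im, zero_mul,
            one_mul, zero_sub]
          linarith
        · refine ⟨false, ?_⟩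
          rw [hprod, hval, Complex.re_ofReal_mul, if_neg Bool.false_ne_true]
          refine mul_pos hcpos ?_
          rw [Complex.inv_I, neg_mul, Complex.neg_re, Complex.mul_re, Complex.I_re, Complex.I_im,
            zero_mul, one_mul, zero_sub, neg_neg]
          exact lt_of_le_of_ne (not_lt.mp hlt) (Ne.symm hz₁i)
      obtain ⟨RV, hRV, δ₁0, δ₂0, hb₁, hb₂, hd₁, hd₂, hI₁, hI₂, hcomp⟩ :=
        C0.exists_lift_pair hRW (N0.homCarrier γO.left) hγd hγI hRX hRXd hRXt φ0 rfl rfl σ hz₁ hre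
      let δ₁N : (⟨⟨C0.mk D0.complex RV hRV⟩⟩ : N0) ⟶ ⟨⟨X0⟩⟩ := N0.homMk δ₁0 hI₁ hd₁
      let δ₂N : (⟨⟨C0.mk D0.complex RV hRV⟩⟩ : N0) ⟶ ⟨⟨C0.mk D0.complex RW hRW⟩⟩ :=
        N0.homMk δ₂0 hI₂ hd₂
      have hcommN : δ₂N ≫ γO.left = δ₁N ≫ sX := N0.hom_ext hcomp.symm
      let rV : R0 := Over.mk (δ₁N ≫ sX)
      let V : R (𝟭 D0) := ⟨rV, D0.complex, Iso.refl _⟩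
      let δ₁O : rV ⟶ rX := Over.homMk δ₁N rfl
      let δ₂O : rV ⟶ ⟨⟨⟨C0.mk D0.complex RW hRW⟩⟩, ⟨⟨⟩⟩, sW⟩ :=
        Over.homMk δ₂N (by rw [← hsW]; exact hcommN)
      have hb₁' : R0.toD0.map δ₁O = D0.Hom.gal σ := hb₁
      have hb₂' : R0.toD0.map δ₂O = 𝟙 D0.complex := hb₂
      have w₁ : R0.toD0.map δ₁O ≫ X.iso.hom = V.iso.hom ≫ (𝟭 D0).map (D0.Hom.gal σ) := by
        rw [hb₁']
        show D0.Hom.gal σ ≫ 𝟙 D0.complex = 𝟙 D0.complex ≫ D0.Hom.gal σ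
        rw [Category.comp_id, Category.id_comp]
      have w₂ : R0.toD0.map δ₂O ≫ ιW.hom = V.iso.hom ≫ (𝟭 D0).map ιW.hom := by
        rw [hb₂']
        rfl
      refine ⟨V, ⟨δ₁O, D0.Hom.gal σ, w₁⟩, ⟨δ₂O, ιW.hom, w₂⟩, ?_⟩
      exact CFP.hom_ext (Over.OverMorphism.ext hcommN.symm) (hsub _ _ _)
  -- the projection of φ to D₀ is `Spec ℂ → Spec ℝ`, which is not a monomorphism
  exact D0.not_mono_toRealHom (hIII φ ⟨hfs, hmono⟩).2

end ArchFrd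

end

end Literature.AlgebraicGeometry.Frobenioids
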